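import Summits.QuantumFields.BalabanUV.Beta.FP.TorusTwoScaleSandwichPeriodic
import Summits.QuantumFields.BalabanUV.Beta.FP.TorusCompositeRowsSymKernel

/-!
# `BalabanUV.Beta.FP.TorusCompositeRowsSymSandwich` — road «FP» for binder row D1, ROUTE T (β1), J-RISK-3′ «THE PACKING AT THE PASS», SPEC-48 (A)+(B1) COMPOSED:
# **ONE STOREY OF leaf-06's COMPANION SUM AT THE NAMED ROWS, FOR ANY CORE: `(compRowsSym …)ᵀ * perF M (dper M 𝒢) * compRowsSym … = perF T (dper T 𝒦)`,
# `𝒦` = THE LATTICE SANDWICH OF `𝒢` BY an2's COMPOSITE LINEAR LEGS AT THE SYM BRICKS — WINDOW-FREE STATEMENT**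

WHY.  The engine `TorusTwoScaleSandwichPeriodic.transpose_mul_perF_dper_mul` (g36 p408072) is carrier-free: it wants the conjugating rows DISPLAYED as a periodised
equivariant windowed two-scale leg.  `TorusCompositeRowsSymKernel` (g36 p408305) supplies exactly those three letters for `Cm := compRowsSym Lc M lev rs n` with the leg
`CL γ a β b := compLinKer ℓ Lc n (b, β) (a, γ)` (an2's F3 composite linear kernel at the brick list `ℓ` displayed below the depth as `stepScale · Lc^{d+1} · symLinKerAt (ctr) Lc`).
This file composes the two: the one-storey packing AT THE NAMED ROWS for ANY core `𝒢 : MKer (d+1) (Fin (d+1))` on the top torus `M` carrying the two summability letters,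
with the sandwich `𝒦` displayed WINDOW-FREE (`Σ'_γ Σ'_γ′`, finitely supported) — the shape in which (B2) (the storey's Λ-core `w k · Σ_ā hb k v ā · SLam N (cf k) symHessFFAt ā|ff`)
and (B4) (an2's contracted unrolling `Σ_σ (liftUpᵀ λ_top) σ · storeyVH σ`) meet it.

WHAT ([folklore] composition BY NAME + one finitely-supported-`tsum` ↔ window-sum conversion; no `def`, no `def … : Prop`, nothing cited, 0 sorry):
**`compRowsSym_transpose_mul_perF_dper_mul`** (hypotheses: `hℓ` the brick list below the depth; `hGd`, `hGp` the core's two summability letters w.r.t. `M`; `h𝒦` the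
window-free display of the sandwich) and its entry form `compRowsSym_sandwich_apply`.
WHAT THIS IS NOT: not the storey core's letters ((B2)), not the storey sum ((B3)), not the row's identification ((B4)); no row of the END wrapper discharged; no estimate;
nothing of Bałaban's asserted, valued or discharged; 0∕4 row-D1 binders (hW, hR, D1Tel, D1Rep); NOT (C1), NOT (T-ID), NOT SDF, NOT D1, NOT BetaPertH, NOT continuum, NOT Clay.

HONEST DEPENDENCY (page 1, mandatory): continuum YM on T⁴ ⇐ BetaPertH ∧ nine spine estimates (0/9 proved); BetaPertH ⇐ (D1) ∧ (D4) ∧ CAP+tail;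
G-an2-4 gates asym, D1 and NE2/3/4.  HONEST FRAMING (cell contract, verbatim): «discharging `BetaPertH` makes Bałaban's UV stability UNCONDITIONAL —
a real constructive-QFT result; it is NOT the continuum limit and NOT the Clay problem.»  ABSOLUTE RULE (cell charter, verbatim): «No internally-minted
statement may enter as a cited fact. Every hypothesis is either kernel-proved in this package or a verbatim quotation of a PUBLISHED theorem with page
reference. The manuscript(s) under audit are NOT citable for their own disputed steps — they are the thing under adjudication; programme-internal
(2001/route/tribunal) claims are never citable.»  Road «FP» OWNER, b2b-balaban-beta-d1-p3 gen 36, 2026-08-25.  No existing file touched.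
-/

noncomputable section

open scoped BigOperators

namespace Summit.QuantumFields.BalabanUV.Beta.FP.TorusCompositeRowsSymSandwich

open Finset Matrix
open Literature.MathematicalPhysics.QuantumFieldTheory.Balaban1983to89
open Literature.MathematicalPhysics.QuantumFieldTheory.Balaban1983to89.Beta
open B4TorusKernel.MultiPeriod (translate)
open B6Lemma24Torus (pbox)
open AffineAveraging (Site)
open AveragingHessianKernels (Bond)
open AveragingContoursRooted (ctr)
open ExpKernelCalculus (MKer)
open Summit.QuantumFields.BalabanUV.Beta.SymAveragingHessianCounts (symLinKerAt)
open Summit.QuantumFields.BalabanUV.Beta.BorderedHessian (stepScale)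
open Summit.QuantumFields.BalabanUV.Beta.CompositeVertexKernelRec (compLinKer)
open Summit.QuantumFields.BalabanUV.Beta.FP.KernelPeriodisationFib (Idx perF perF_apply perZ)
open Summit.QuantumFields.BalabanUV.Beta.FP.KernelPeriodisationFibLoc (dper)
open Summit.QuantumFields.BalabanUV.Beta.FP.TorusCompositeObjects (towerTorus)
open Summit.QuantumFields.BalabanUV.Beta.FP.TorusCompositeObjectsG (compRowsSym)
open Summit.QuantumFields.BalabanUV.Beta.FP.TorusTwoScaleSandwichPeriodic (transpose_mul_perF_dper_mul)
open Summit.QuantumFields.BalabanUV.Beta.FP.TorusCompositeRowsSymKernel (rowsLeg_translate exists_rowsLeg_window compRowsSym_eq_periodised_leg)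

variable {d : ℕ} (Lc : ℕ) [NeZero Lc] (M : Fin (d + 1) → ℕ) [∀ μ, NeZero (M μ)] (lev : ℕ → ℕ) (rs : ℕ → (Fin (d + 1) → ℕ)) (n : ℕ)
  (ℓ : ℕ → Fin (d + 1) → Site (d + 1) → Bond (d + 1) → ℝ)

/-- [folklore] **`compRowsSym_transpose_mul_perF_dper_mul` — ONE STOREY PACKED AT THE NAMED ROWS, ANY CORE**: for the brick list `ℓ` displayed below the depth
(`hℓ`), a core `𝒢` on the top torus `M` with summable diagonal `M`-translates (`hGd`) and summable second-argument `M`-translates of `dper M 𝒢` (`hGp`), and the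
sandwich `𝒦` displayed window-free (`h𝒦`, fibres outermost):
`(compRowsSym Lc M lev rs n)ᵀ * perF M (dper M 𝒢) * compRowsSym Lc M lev rs n = perF (towerTorus Lc M n) (dper (towerTorus Lc M n) 𝒦)`. -/
theorem compRowsSym_transpose_mul_perF_dper_mul
    (hℓ : ∀ i < n, ∀ (μ : Fin (d + 1)) (y : Site (d + 1)) (g : Bond (d + 1)),
      ℓ i μ y g = stepScale d Lc (lev (n - i)) * ((Lc : ℝ) ^ (d + 1) * symLinKerAt (ctr (d + 1) Lc) Lc μ y g))
    (𝒢 : MKer (d + 1) (Fin (d + 1)))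
    (hGd : ∀ (γ γ' : Site (d + 1)) (a a' : Fin (d + 1)), Summable fun m₀ : Site (d + 1) => 𝒢 (translate M γ m₀) (translate M γ' m₀) a a')
    (hGp : ∀ (γ γ' : Site (d + 1)) (a a' : Fin (d + 1)), Summable fun m : Site (d + 1) => dper M 𝒢 γ (translate M γ' m) a a')
    {𝒦 : MKer (d + 1) (Fin (d + 1))}
    (h𝒦 : ∀ (β β' : Site (d + 1)) (b b' : Fin (d + 1)), 𝒦 β β' b b'
      = ∑ a : Fin (d + 1), ∑ a' : Fin (d + 1), ∑' γ : Site (d + 1), ∑' γ' : Site (d + 1),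
          compLinKer ℓ Lc n (b, β) (a, γ) * 𝒢 γ γ' a a' * compLinKer ℓ Lc n (b', β') (a', γ')) :
    (compRowsSym Lc M lev rs n)ᵀ * perF M (dper M 𝒢) * compRowsSym Lc M lev rs n
      = perF (towerTorus Lc M n) (dper (towerTorus Lc M n) 𝒦) := by
  obtain ⟨S, hS⟩ := exists_rowsLeg_window Lc n ℓ
  -- the window-free display is the window display
  have hK' : ∀ (β β' : Site (d + 1)) (b b' : Fin (d + 1)), 𝒦 β β' b b'
      = ∑ a : Fin (d + 1), ∑ a' : Fin (d + 1), ∑ γ ∈ S β, ∑ γ' ∈ S β',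
          compLinKer ℓ Lc n (b, β) (a, γ) * 𝒢 γ γ' a a' * compLinKer ℓ Lc n (b', β') (a', γ') := by
    intro β β' b b'
    rw [h𝒦]
    refine Finset.sum_congr rfl fun a _ => Finset.sum_congr rfl fun a' _ => ?_
    have hin : ∀ γ : Site (d + 1), ∑' γ' : Site (d + 1), compLinKer ℓ Lc n (b, β) (a, γ) * 𝒢 γ γ' a a' * compLinKer ℓ Lc n (b', β') (a', γ')
        = ∑ γ' ∈ S β', compLinKer ℓ Lc n (b, β) (a, γ) * 𝒢 γ γ' a a' * compLinKer ℓ Lc n (b', β') (a', γ') :=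
      fun γ => tsum_eq_sum fun γ' hγ' => by rw [hS γ' a' β' b' hγ', mul_zero]
    simp_rw [hin]
    exact tsum_eq_sum fun γ hγ => Finset.sum_eq_zero fun γ' _ => by rw [hS γ a β b hγ, zero_mul, zero_mul]
  exact transpose_mul_perF_dper_mul M (towerTorus Lc M n) (fun γ a β b => compLinKer ℓ Lc n (b, β) (a, γ))
    (fun m γ a β b => rowsLeg_translate Lc M lev n ℓ hℓ m γ a β b) S (fun γ a β b h => hS γ a β b h) 𝒢 hGd hGp hK'
    (C := fun α a β b => ∑' m : Site (d + 1), compLinKer ℓ Lc n (b, translate (towerTorus Lc M n) β m) (a, α)) (fun _ _ _ _ => rfl)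
    (fun p q => compRowsSym_eq_periodised_leg Lc M lev rs n ℓ hℓ p q)

/-- [folklore] entry form of `compRowsSym_transpose_mul_perF_dper_mul` (`perF_apply`). -/
theorem compRowsSym_sandwich_apply
    (hℓ : ∀ i < n, ∀ (μ : Fin (d + 1)) (y : Site (d + 1)) (g : Bond (d + 1)),
      ℓ i μ y g = stepScale d Lc (lev (n - i)) * ((Lc : ℝ) ^ (d + 1) * symLinKerAt (ctr (d + 1) Lc) Lc μ y g))
    (𝒢 : MKer (d + 1) (Fin (d + 1)))
    (hGd : ∀ (γ γ' : Site (d + 1)) (a a' : Fin (d + 1)), Summable fun m₀ : Site (d + 1) => 𝒢 (translate M γ m₀) (translate M γ' m₀) a a')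
    (hGp : ∀ (γ γ' : Site (d + 1)) (a a' : Fin (d + 1)), Summable fun m : Site (d + 1) => dper M 𝒢 γ (translate M γ' m) a a')
    {𝒦 : MKer (d + 1) (Fin (d + 1))}
    (h𝒦 : ∀ (β β' : Site (d + 1)) (b b' : Fin (d + 1)), 𝒦 β β' b b'
      = ∑ a : Fin (d + 1), ∑ a' : Fin (d + 1), ∑' γ : Site (d + 1), ∑' γ' : Site (d + 1),
          compLinKer ℓ Lc n (b, β) (a, γ) * 𝒢 γ γ' a a' * compLinKer ℓ Lc n (b', β') (a', γ'))
    (q q' : ↥(pbox (towerTorus Lc M n)) × Fin (d + 1)) :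
    ((compRowsSym Lc M lev rs n)ᵀ * perF M (dper M 𝒢) * compRowsSym Lc M lev rs n) q q'
      = perZ (towerTorus Lc M n) (dper (towerTorus Lc M n) 𝒦) (q.1 : Site (d + 1)) (q'.1 : Site (d + 1)) q.2 q'.2 := by
  rw [compRowsSym_transpose_mul_perF_dper_mul Lc M lev rs n ℓ hℓ 𝒢 hGd hGp h𝒦, perF_apply]

end Summit.QuantumFields.BalabanUV.Beta.FP.TorusCompositeRowsSymSandwich

end
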